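import Summits.QuantumAdvantage.QuantumAdvantage.Theorems.CubicForrelationNearExactIsExactCubicFormR4ZAffine

/-!
# Crux `CubicForrelation.NearExactIsExact` (stmt-QuantumAdvantage-14043) — E1280-even, R4 branch, descendant `0` (`HZ`): the COSET
  STRUCTURE of an affine family of tables vanishing at three points

Certificate seat `b2b-cforr-cert` (gen 43).  HONEST FRAMING: kernel-checked bookkeeping (standard axioms) for R4-PARTNER §4 (`w = 2, 3`):
the forms `β_v` of the cells form a family `T v` of tables which is AFFINE in `v ∈ 𝔽₂⁴` (`T(a⊕b⊕c) = T a ⊕ T b ⊕ T c`) and vanishes at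
three distinct zero cells `z₁, z₂, z₃`; with `D = {0, z₁⊕z₂, z₁⊕z₃, z₂⊕z₃}` and transversal unit vectors `e_i, e_j` (…CubicFormR4ZAffine
`tq0_transversal`), every `v` is `z₁ ⊕ c_x e_i ⊕ c_y e_j` modulo `D` and `T v = c_x·T(z₁⊕e_i) ⊕ c_y·T(z₁⊕e_j)` (`tq0_coset`).  Also the
conversions between the `Bool`-coded membership in `D` used by the `decide` lemmas and vector equalities (`tq0_inD_of_bool`,
`tq0_not_inD_of_bool`).  Nothing about `θ₁₂`; NOT summit progress.

References: this seat lineage (g37 R4-PARTNER §4, g43 LEAN-GEN43).  Axioms: the standard three.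
-/

set_option linter.dupNamespace false -- D-0017: single-problem summit ⇒ `QuantumAdvantage.QuantumAdvantage` by design

namespace Summit.QuantumAdvantage.QuantumAdvantage.Theorems.CubicForrelation.NearExactIsExact

open Finset
open Literature.Computability.QuantumComplexity
open Literature.Computability.QuantumComplexity.BuzetChailloux (bxor zeroVec bxor_comm bxor_self bxor_zeroVec zeroVec_bxor
  bxor_bxor_cancel_left)

/-- From the `Bool`-coded membership in `D = {0, z₁⊕z₂, z₁⊕z₃, z₂⊕z₃}` to vector equalities. [folklore] -/
theorem tq0_inD_of_bool (z₁ z₂ z₃ x : Fin 4 → Bool)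
    (h : ((!x 0 && !x 1 && !x 2 && !x 3) || ((x 0 == (bxor z₁ z₂) 0) && (x 1 == (bxor z₁ z₂) 1) && (x 2 == (bxor z₁ z₂) 2) && (x 3 == (bxor z₁ z₂) 3)) || ((x 0 == (bxor z₁ z₃) 0) && (x 1 == (bxor z₁ z₃) 1) && (x 2 == (bxor z₁ z₃) 2) && (x 3 == (bxor z₁ z₃) 3)) || ((x 0 == ((bxor z₁ z₂) 0 ^^ (bxor z₁ z₃) 0)) && (x 1 == ((bxor z₁ z₂) 1 ^^ (bxor z₁ z₃) 1)) && (x 2 == ((bxor z₁ z₂) 2 ^^ (bxor z₁ z₃) 2)) && (x 3 == ((bxor z₁ z₂) 3 ^^ (bxor z₁ z₃) 3)))) = true) :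
    (x = zeroVec ∨ x = bxor z₁ z₂ ∨ x = bxor z₁ z₃ ∨ x = bxor z₂ z₃) := by
  have key : ∀ y : Fin 4 → Bool, ((x 0 == y 0) && (x 1 == y 1) && (x 2 == y 2) && (x 3 == y 3)) = true → x = y := by
    intro y hy
    simp only [Bool.and_eq_true, beq_iff_eq] at hy
    obtain ⟨⟨⟨h0, h1⟩, h2⟩, h3⟩ := hy
    funext l
    have hl : l = 0 ∨ l = 1 ∨ l = 2 ∨ l = 3 := by fin_cases l <;> simp
    rcases hl with rfl | rfl | rfl | rfl
    · exact h0
    · exact h1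
    · exact h2
    · exact h3
  have e23 : bxor z₂ z₃ = fun t => (bxor z₁ z₂) t ^^ (bxor z₁ z₃) t := by
    funext t; simp only [bxor]; cases z₁ t <;> cases z₂ t <;> cases z₃ t <;> rfl
  simp only [Bool.or_eq_true] at h
  rcases h with ((h0 | h1) | h2) | h3
  · left
    funext l
    simp only [Bool.and_eq_true, Bool.not_eq_true'] at h0
    obtain ⟨⟨⟨a0, a1⟩, a2⟩, a3⟩ := h0
    have hl : l = 0 ∨ l = 1 ∨ l = 2 ∨ l = 3 := by fin_cases l <;> simp
    rcases hl with rfl | rfl | rfl | rfl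
    · exact a0
    · exact a1
    · exact a2
    · exact a3
  · right; left; exact key _ h1
  · right; right; left; exact key _ h2
  · right; right; right; rw [e23]; exact key _ h3

/-- From the `Bool`-coded NON-membership in `D` to the negation of the vector equalities. [folklore] -/
theorem tq0_not_inD_of_bool (z₁ z₂ z₃ x : Fin 4 → Bool)
    (h : ((!x 0 && !x 1 && !x 2 && !x 3) || ((x 0 == (bxor z₁ z₂) 0) && (x 1 == (bxor z₁ z₂) 1) && (x 2 == (bxor z₁ z₂) 2) && (x 3 == (bxor z₁ z₂) 3)) || ((x 0 == (bxor z₁ z₃) 0) && (x 1 == (bxor z₁ z₃) 1) && (x 2 == (bxor z₁ z₃) 2) && (x 3 == (bxor z₁ z₃) 3)) || ((x 0 == ((bxor z₁ z₂) 0 ^^ (bxor z₁ z₃) 0)) && (x 1 == ((bxor z₁ z₂) 1 ^^ (bxor z₁ z₃) 1)) && (x 2 == ((bxor z₁ z₂) 2 ^^ (bxor z₁ z₃) 2)) && (x 3 == ((bxor z₁ z₂) 3 ^^ (bxor z₁ z₃) 3)))) = false) :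
    ¬ (x = zeroVec ∨ x = bxor z₁ z₂ ∨ x = bxor z₁ z₃ ∨ x = bxor z₂ z₃) := by
  have e23 : ∀ t, (bxor z₂ z₃) t = ((bxor z₁ z₂) t ^^ (bxor z₁ z₃) t) := by
    intro t; simp only [bxor]; cases z₁ t <;> cases z₂ t <;> cases z₃ t <;> rfl
  rintro (hx | hx | hx | hx) <;> subst hx
  · simp [zeroVec] at h
  · simp at h
  · simp at h
  · rw [e23 0, e23 1, e23 2, e23 3] at h
    simp at h

/-- **The coset structure.**  See the module docstring.  `T : 𝔽₂⁴ → tables` affine, vanishing at `z₁, z₂, z₃`; `e_i, e_j` with the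
decompositions `e_m ⊕ x_i e_i ⊕ x_j e_j ∈ D` for all unit vectors `e_m`.  Then every `v` has coordinates `(c_x, c_y)` with
`T v = c_x·T(z₁⊕e_i) ⊕ c_y·T(z₁⊕e_j)` and `v ⊕ z₁ ⊕ c_x e_i ⊕ c_y e_j ∈ D`. [this work] -/
theorem tq0_coset (T : (Fin 4 → Bool) → Fin 7 → Fin 7 → Bool)
    (hT3 : ∀ (j' k' : Fin 7) (a b c : Fin 4 → Bool), T (bxor (bxor a b) c) j' k' = ((T a j' k' ^^ T b j' k') ^^ T c j' k'))
    (z₁ z₂ z₃ : Fin 4 → Bool) (hz₁ : ∀ j' k', T z₁ j' k' = false) (hz₂ : ∀ j' k', T z₂ j' k' = false) (hz₃ : ∀ j' k', T z₃ j' k' = false)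
    (i j : Fin 4)
    (hdec : ∀ m : Fin 4, ∃ xi xj : Bool,
      ((bxor (bxor (fun l => decide (l = m)) (fun l => xi && decide (l = i))) (fun l => xj && decide (l = j))) = zeroVec ∨ (bxor (bxor (fun l => decide (l = m)) (fun l => xi && decide (l = i))) (fun l => xj && decide (l = j))) = bxor z₁ z₂ ∨ (bxor (bxor (fun l => decide (l = m)) (fun l => xi && decide (l = i))) (fun l => xj && decide (l = j))) = bxor z₁ z₃ ∨ (bxor (bxor (fun l => decide (l = m)) (fun l => xi && decide (l = i))) (fun l => xj && decide (l = j))) = bxor z₂ z₃)) :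
    ∀ v : Fin 4 → Bool, ∃ cx cy : Bool,
      (∀ j' k', T v j' k' = ((cx && T (bxor z₁ (fun l => decide (l = i))) j' k') ^^ (cy && T (bxor z₁ (fun l => decide (l = j))) j' k'))) ∧
      ((bxor (bxor (bxor v z₁) (fun l => cx && decide (l = i))) (fun l => cy && decide (l = j))) = zeroVec ∨ (bxor (bxor (bxor v z₁) (fun l => cx && decide (l = i))) (fun l => cy && decide (l = j))) = bxor z₁ z₂ ∨ (bxor (bxor (bxor v z₁) (fun l => cx && decide (l = i))) (fun l => cy && decide (l = j))) = bxor z₁ z₃ ∨ (bxor (bxor (bxor v z₁) (fun l => cx && decide (l = i))) (fun l => cy && decide (l = j))) = bxor z₂ z₃) := by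
  -- `T` is invariant under translations by `D`
  have hD : ∀ (w δ : Fin 4 → Bool), (δ = zeroVec ∨ δ = bxor z₁ z₂ ∨ δ = bxor z₁ z₃ ∨ δ = bxor z₂ z₃) → ∀ j' k', T (bxor w δ) j' k' = T w j' k' := by
    intro w δ hδ j' k'
    rcases hδ with rfl | rfl | rfl | rfl
    · rw [bxor_zeroVec]
    · rw [show bxor w (bxor z₁ z₂) = bxor (bxor w z₁) z₂ from (iw_bxor_assoc w z₁ z₂).symm, hT3, hz₁, hz₂]
      cases T w j' k' <;> rfl
    · rw [show bxor w (bxor z₁ z₃) = bxor (bxor w z₁) z₃ from (iw_bxor_assoc w z₁ z₃).symm, hT3, hz₁, hz₃]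
      cases T w j' k' <;> rfl
    · rw [show bxor w (bxor z₂ z₃) = bxor (bxor w z₂) z₃ from (iw_bxor_assoc w z₂ z₃).symm, hT3, hz₂, hz₃]
      cases T w j' k' <;> rfl
  -- `D` is closed under `⊕`
  have hDD : ∀ (δ δ' : Fin 4 → Bool), (δ = zeroVec ∨ δ = bxor z₁ z₂ ∨ δ = bxor z₁ z₃ ∨ δ = bxor z₂ z₃) → (δ' = zeroVec ∨ δ' = bxor z₁ z₂ ∨ δ' = bxor z₁ z₃ ∨ δ' = bxor z₂ z₃) → ((bxor δ δ') = zeroVec ∨ (bxor δ δ') = bxor z₁ z₂ ∨ (bxor δ δ') = bxor z₁ z₃ ∨ (bxor δ δ') = bxor z₂ z₃) := by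
    intro δ δ' hδ hδ'
    have v12_13 : bxor (bxor z₁ z₂) (bxor z₁ z₃) = bxor z₂ z₃ := by
      funext t; simp only [bxor]; cases z₁ t <;> cases z₂ t <;> cases z₃ t <;> rfl
    have v12_23 : bxor (bxor z₁ z₂) (bxor z₂ z₃) = bxor z₁ z₃ := by
      funext t; simp only [bxor]; cases z₁ t <;> cases z₂ t <;> cases z₃ t <;> rfl
    have v13_23 : bxor (bxor z₁ z₃) (bxor z₂ z₃) = bxor z₁ z₂ := by
      funext t; simp only [bxor]; cases z₁ t <;> cases z₂ t <;> cases z₃ t <;> rfl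
    rcases hδ with rfl | rfl | rfl | rfl <;> rcases hδ' with rfl | rfl | rfl | rfl
    · left; rw [bxor_self]
    · right; left; rw [zeroVec_bxor]
    · right; right; left; rw [zeroVec_bxor]
    · right; right; right; rw [zeroVec_bxor]
    · right; left; rw [bxor_zeroVec]
    · left; rw [bxor_self]
    · right; right; right; rw [v12_13]
    · right; right; left; rw [v12_23]
    · right; right; left; rw [bxor_zeroVec]
    · right; right; right; rw [bxor_comm, v12_13]
    · left; rw [bxor_self]
    · right; left; rw [v13_23]
    · right; right; right; rw [bxor_zeroVec]
    · right; right; left; rw [bxor_comm, v12_23]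
    · right; left; rw [bxor_comm, v13_23]
    · left; rw [bxor_self]
  -- the tables at `z₁ ⊕ x_i e_i ⊕ x_j e_j`
  have hcorner : ∀ (xi xj : Bool) (j' k' : Fin 7), T (bxor (bxor z₁ (fun l => xi && decide (l = i))) (fun l => xj && decide (l = j))) j' k' =
      ((xi && T (bxor z₁ (fun l => decide (l = i))) j' k') ^^ (xj && T (bxor z₁ (fun l => decide (l = j))) j' k')) := by
    intro xi xj j' k'
    cases xi <;> cases xj
    · rw [tcf_smul_false, tcf_smul_false, bxor_zeroVec, bxor_zeroVec, hz₁]; rfl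
    · rw [tcf_smul_false, tcf_smul_true, bxor_zeroVec, Bool.false_and, Bool.true_and, Bool.false_xor]
    · rw [tcf_smul_true, tcf_smul_false, bxor_zeroVec, Bool.false_and, Bool.true_and, Bool.xor_false]
    · rw [tcf_smul_true, tcf_smul_true,
        show bxor (bxor z₁ (fun l => decide (l = i))) (fun l => decide (l = j)) = bxor (bxor (bxor z₁ (fun l => decide (l = i))) z₁) (bxor z₁ (fun l => decide (l = j))) from by
          funext t; simp only [bxor]; cases z₁ t <;> cases decide (t = i) <;> cases decide (t = j) <;> rfl,
        hT3, hz₁, Bool.true_and, Bool.true_and]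
      cases T (bxor z₁ fun l => decide (l = i)) j' k' <;> cases T (bxor z₁ fun l => decide (l = j)) j' k' <;> rfl
  -- induction over `u = v ⊕ z₁`
  suffices H : ∀ u : Fin 4 → Bool, ∃ cx cy : Bool,
      (∀ j' k', T (bxor z₁ u) j' k' = ((cx && T (bxor z₁ (fun l => decide (l = i))) j' k') ^^ (cy && T (bxor z₁ (fun l => decide (l = j))) j' k'))) ∧
      ((bxor (bxor u (fun l => cx && decide (l = i))) (fun l => cy && decide (l = j))) = zeroVec ∨ (bxor (bxor u (fun l => cx && decide (l = i))) (fun l => cy && decide (l = j))) = bxor z₁ z₂ ∨ (bxor (bxor u (fun l => cx && decide (l = i))) (fun l => cy && decide (l = j))) = bxor z₁ z₃ ∨ (bxor (bxor u (fun l => cx && decide (l = i))) (fun l => cy && decide (l = j))) = bxor z₂ z₃) by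
    intro v
    obtain ⟨cx, cy, hT, hI⟩ := H (bxor v z₁)
    refine ⟨cx, cy, fun j' k' => ?_, hI⟩
    rw [← hT j' k', show bxor z₁ (bxor v z₁) = v from by rw [bxor_comm, iw_bxor_assoc, bxor_self, bxor_zeroVec]]
  refine tq0_units_induction _ ?_ ?_
  · refine ⟨false, false, fun j' k' => ?_, ?_⟩
    · rw [bxor_zeroVec, hz₁]; rfl
    · left; rw [tcf_smul_false, tcf_smul_false, bxor_zeroVec, bxor_zeroVec]
  · intro u m hu
    obtain ⟨cx, cy, hT, hI⟩ := hu
    obtain ⟨xi, xj, hm⟩ := hdec m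
    refine ⟨cx ^^ xi, cy ^^ xj, fun j' k' => ?_, ?_⟩
    · -- `T(z₁ ⊕ u ⊕ e_m) = T(z₁ ⊕ u) ⊕ T(z₁) ⊕ T(z₁ ⊕ e_m)`
      rw [show bxor z₁ (bxor u (fun l => decide (l = m))) = bxor (bxor (bxor z₁ u) z₁) (bxor z₁ (fun l => decide (l = m))) from by
          funext t; simp only [bxor]; cases z₁ t <;> cases u t <;> cases decide (t = m) <;> rfl,
        hT3, hz₁, hT j' k', Bool.xor_false]
      -- `T(z₁ ⊕ e_m) = x_i X ⊕ x_j Y` via `e_m = x_i e_i ⊕ x_j e_j ⊕ δ'`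
      rw [show bxor z₁ (fun l => decide (l = m)) =
          bxor (bxor (bxor z₁ (fun l => xi && decide (l = i))) (fun l => xj && decide (l = j))) (bxor (bxor (fun l => decide (l = m)) (fun l => xi && decide (l = i))) (fun l => xj && decide (l = j))) from by
          funext t; simp only [bxor]; cases z₁ t <;> cases decide (t = m) <;> cases (xi && decide (t = i)) <;> cases (xj && decide (t = j)) <;> rfl,
        hD _ _ hm, hcorner]
      cases T (bxor z₁ fun l => decide (l = i)) j' k' <;> cases T (bxor z₁ fun l => decide (l = j)) j' k' <;>
        cases cx <;> cases cy <;> cases xi <;> cases xj <;> rfl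
    · rw [show bxor (bxor (bxor u (fun l => decide (l = m))) (fun l => (cx ^^ xi) && decide (l = i))) (fun l => (cy ^^ xj) && decide (l = j)) =
          bxor (bxor (bxor u (fun l => cx && decide (l = i))) (fun l => cy && decide (l = j))) (bxor (bxor (fun l => decide (l = m)) (fun l => xi && decide (l = i))) (fun l => xj && decide (l = j))) from by
          funext t; simp only [bxor]; cases u t <;> cases decide (t = m) <;> cases decide (t = i) <;> cases decide (t = j) <;>
            cases cx <;> cases cy <;> cases xi <;> cases xj <;> rfl]
      exact hDD _ _ hI hm

end Summit.QuantumAdvantage.QuantumAdvantage.Theorems.CubicForrelation.NearExactIsExact
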